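import Summits.QuantumFields.YangMills.Theorems.BalabanUVNodesN13WilsonPartitionFnAxialTreeUpperBound
import Summits.QuantumFields.YangMills.Theorems.BalabanUVNodesN13ZNormLaplaceUpperSU
import Summits.QuantumFields.YangMills.Theorems.BalabanUVNodesN13GaugeFixingAxialLayers

/-!
# BalabanUVNodes ∕ N13 — THE GAUSSIAN UPPER BOUND ON BAŁABAN's FINE-LATTICE WILSON PARTITION FUNCTION, `G = SU(N)`: `log Z_P(β) ≤ −((d−1)(N²−1)∕2)(1−1∕n)|T₁^{(0)}| log β + (d−1)(1−1∕n)|T₁^{(0)}| log(D_N T_N)`,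
# and the TWO-SIDED Gaussian asymptotics of `log Z` in the kernel

(Track A, DAG node N13 = [B16]; cluster K1 — K1⁹ `StabilityBRunRowsAtRecordR13SepCoPHV` = stmt-QuantumFields-27364, helper; seat `pub-ymgap-dag-n13-w3` g6, INTENT-3; 2026-08-28; count-neutral.)
BY NAME from two files: this seat's axial-tree comparison `log Z_P(β) ≤ (d−1)(1−1∕n)|T| log linkMass(β)` (`…N13WilsonPartitionFnAxialTreeUpperBound`, generic regular `G`) and dag-n13-w1 g6's
one-plaquette Laplace bound on `SU(N)` (`…N13ZNormLaplaceUpperSU.integral_gaugeFix_SU_le`: `∫_{SU(N)} e^{−(1−Re tr u)∕g²} du ≤ D_N T_N g^{N²−1}`, from the tree's explicit small-ball law).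
* §1 `linkMass_SU_eq_integral_gaugeFix` (`linkMass β` IS that integral at `g = β^{−1∕2}`; `HaarData.haar = haarProbability` by `rfl`), ★ `linkMass_SU_le`, ★★ `log_linkMass_SU_le`
  (`log linkMass_{SU(N)}(β) ≤ −((N²−1)∕2) log β + log(D_N T_N)`, `β > 0`), ★ `log_linkMass_SU_ge` (`≥ −((N²−1)∕2) log β − C_z^{SU}(N,1)`, `β ≥ 1`, from `B16ZLower`): two-sided.
* §2 ★★★ `log_partitionFn_le_gaussian_specialUnitary` — for every `Params` `P` and `β ≥ 1`:
  `log Z_P(β) ≤ −((d−1)(N²−1)∕2)·(1−1∕n)·|T₁^{(0)}|·log β + (d−1)(1−1∕n)|T₁^{(0)}|·log(D_N T_N)` (`n = 2L^{m+K}`); `…_d4`: coefficient `(3∕2)(N²−1)(1−1∕n)`.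
* §3 ★★★ `log_partitionFn_twoSided_gaussian_d4` — with this seat's g5 lower bound p639903 (`log_partitionFn_ge_axialLayers_specialUnitary_d4`):
  `−(3+1∕n)|T|(((N²−1)∕2) log β + C_N) − 128|T| ≤ log Z_P(β) ≤ −3(1−1∕n)|T|((N²−1)∕2) log β + 3(1−1∕n)|T| log(D_N T_N)` — `log Z_P(β) = −(3∕2)(N²−1)|T₁^{(0)}| log β·(1 + O(1∕n)) + O(|T₁^{(0)}|)`:
  the transversal Gaussian count of the `d = 4` torus, both sides in the kernel.
HONEST FRAMING: elementary; nothing of Bałaban's asserted or refuted; no skeleton ∕ route text touched; N13 NOT discharged; K1⁹ NEITHER proved NOR refuted; no stub closed; counts UNMOVED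
(typed 28∕28 · discharged 5∕27 · A 5∕28); one finite 𝕋⁴ at fixed ε; R4 closes the conditional finite-𝕋⁴ rung `BalabanLadder.UV` only — the Yang–Mills mass gap (Clay) is NOT proved by any of
this; nothing continuum ∕ ℝ⁴ ∕ OS.  No `sorry`, `def`, `instance`, `notation`.
-/

noncomputable section

open MeasureTheory
open scoped BigOperators

namespace Summit.QuantumFields.YangMills.BalabanUVNodes.N13WilsonPartitionFnGaussianUpperBoundSU

open Literature.MathematicalPhysics.QuantumFieldTheory (haarProbability)
open Literature.MathematicalPhysics.QuantumFieldTheory.UnitaryCayley (haarChartConst)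
open Literature.MathematicalPhysics.QuantumFieldTheory.Balaban1983to89
open Literature.MathematicalPhysics.QuantumFieldTheory.Balaban1983to89.Missing
open Summit.QuantumFields.BalabanUV.T4Continuum.NE7b.BarePartitionFnDecay (plaqFactor plaqFactor_pos integrable_plaqFactor linkMass)
open Summit.QuantumFields.YangMills.BalabanUVNodes.N13WilsonPartitionFnAxialTreeUpperBound (log_partitionFn_le_axialTree linkMass_pos)
open Summit.QuantumFields.YangMills.BalabanUVNodes.N13ZNormLaplaceUpperSU (integral_gaugeFix_SU_le one_le_DT)
open Summit.QuantumFields.YangMills.BalabanUVNodes.N13GaugeFixingAxialLayers (log_partitionFn_ge_axialLayers_specialUnitary_d4)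

variable (N : ℕ) [NeZero N]

/-! ## §1. The one-plaquette mass on `SU(N)`: `log linkMass(β) ≤ −((N²−1)∕2) log β + log(D_N T_N)` -/

/-- `linkMass_{SU(N)}(β) = ∫_{SU(N)} e^{−(1∕g²)(1 − Re tr u)} du` at `g = (√β)⁻¹` (`HaarData.haar = haarProbability` definitionally). [folklore] -/
theorem linkMass_SU_eq_integral_gaugeFix {β : ℝ} (hβ : 0 < β) :
    linkMass (G := Matrix.specialUnitaryGroup (Fin N) ℂ) β =
      ∫ u, Real.exp (-(1 / ((Real.sqrt β)⁻¹) ^ 2) * (1 - GaugeGroup.reTr u)) ∂(haarProbability (Matrix.specialUnitaryGroup (Fin N) ℂ)) := by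
  have hg : 1 / ((Real.sqrt β)⁻¹) ^ 2 = β := by
    rw [inv_pow, Real.sq_sqrt hβ.le, one_div, inv_inv]
  rw [hg]
  rfl

/-- ★ **`linkMass_{SU(N)}(β) ≤ D_N·T_N·(√β)^{−(N²−1)}`** for `β > 0` (dag-n13-w1 g6's `integral_gaugeFix_SU_le` at `g = β^{−1∕2}`). [folklore] -/
theorem linkMass_SU_le {β : ℝ} (hβ : 0 < β) :
    linkMass (G := Matrix.specialUnitaryGroup (Fin N) ℂ) β ≤
      max (Real.pi * (haarChartConst N : ℝ) * 5 ^ (N * N) * (volume (Metric.closedBall (0 : EuclideanSpace ℝ (Fin N × Fin N)) 1)).toReal) (10 ^ (N * N - 1))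
        * (∑' k : ℕ, ((k : ℝ) + 1) ^ (N * N - 1) * Real.exp (-(1 / (2 * (N : ℝ)))) ^ k) * (Real.sqrt β)⁻¹ ^ (N * N - 1) := by
  rw [linkMass_SU_eq_integral_gaugeFix N hβ]
  exact integral_gaugeFix_SU_le (N := N) (inv_pos.2 (Real.sqrt_pos.2 hβ))

/-- ★★ **LOG FORM**: `log linkMass_{SU(N)}(β) ≤ −((N²−1)∕2)·log β + log(D_N T_N)` for `β > 0`. [folklore] -/
theorem log_linkMass_SU_le {β : ℝ} (hβ : 0 < β) :
    Real.log (linkMass (G := Matrix.specialUnitaryGroup (Fin N) ℂ) β) ≤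
      -((((N * N : ℕ) : ℝ) - 1) / 2) * Real.log β +
        Real.log (max (Real.pi * (haarChartConst N : ℝ) * 5 ^ (N * N) * (volume (Metric.closedBall (0 : EuclideanSpace ℝ (Fin N × Fin N)) 1)).toReal) (10 ^ (N * N - 1))
          * (∑' k : ℕ, ((k : ℝ) + 1) ^ (N * N - 1) * Real.exp (-(1 / (2 * (N : ℝ)))) ^ k)) := by
  set DT : ℝ := max (Real.pi * (haarChartConst N : ℝ) * 5 ^ (N * N) * (volume (Metric.closedBall (0 : EuclideanSpace ℝ (Fin N × Fin N)) 1)).toReal) (10 ^ (N * N - 1))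
          * (∑' k : ℕ, ((k : ℝ) + 1) ^ (N * N - 1) * Real.exp (-(1 / (2 * (N : ℝ)))) ^ k) with hDT
  have hDT1 : 1 ≤ DT := one_le_DT
  have hsq : 0 < Real.sqrt β := Real.sqrt_pos.2 hβ
  have hpow : 0 < (Real.sqrt β)⁻¹ ^ (N * N - 1) := pow_pos (inv_pos.2 hsq) _
  have h := Real.log_le_log (linkMass_pos (G := Matrix.specialUnitaryGroup (Fin N) ℂ) β) (linkMass_SU_le N hβ)
  rw [← hDT, Real.log_mul (by positivity) hpow.ne', Real.log_pow, Real.log_inv, Real.log_sqrt hβ.le] at h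
  have hNN : 1 ≤ N * N := Nat.one_le_iff_ne_zero.2 (Nat.mul_ne_zero (NeZero.ne N) (NeZero.ne N))
  have hcast : ((N * N - 1 : ℕ) : ℝ) = ((N * N : ℕ) : ℝ) - 1 := by rw [Nat.cast_sub hNN, Nat.cast_one]
  rw [hcast] at h
  linarith

/-- ★ **THE MATCHING LOWER BOUND** (the tree's `B16ZLower.log_zNorm_specialUnitaryGroup_ge`, since `linkMass β ≥ z(β⁻¹, 1)`, the ball-restricted integral of the same
non-negative integrand): `log linkMass_{SU(N)}(β) ≥ −((N²−1)∕2)·log β − C_z^{SU}(N, 1)` for `β ≥ 1` — with `log_linkMass_SU_le`, `|log linkMass_{SU(N)}(β) + ((N²−1)∕2) log β| = O_N(1)`. [folklore] -/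
theorem log_linkMass_SU_ge {β : ℝ} (hβ : 1 ≤ β) :
    -((((N * N : ℕ) : ℝ) - 1) / 2) * Real.log β - B16ZLower.CzSU N 1 ≤
      Real.log (linkMass (G := Matrix.specialUnitaryGroup (Fin N) ℂ) β) := by
  have hβ0 : 0 < β := lt_of_lt_of_le one_pos hβ
  have hsq : 0 < Real.sqrt β := Real.sqrt_pos.2 hβ0
  have hg : 0 < (Real.sqrt β)⁻¹ := inv_pos.2 hsq
  have hg1 : (Real.sqrt β)⁻¹ ≤ 1 := inv_le_one_of_one_le₀ (Real.one_le_sqrt.2 hβ)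
  haveI := HaarData.isProb (G := Matrix.specialUnitaryGroup (Fin N) ℂ)
  -- `z(g², 1) ≤ linkMass β` at `g = (√β)⁻¹`: restricted ≤ unrestricted integral of a non-negative integrable function
  have hz : B16ZLower.zNorm (Matrix.specialUnitaryGroup (Fin N) ℂ) ((Real.sqrt β)⁻¹ ^ 2) 1 ≤ linkMass (G := Matrix.specialUnitaryGroup (Fin N) ℂ) β := by
    have hα : 1 / ((Real.sqrt β)⁻¹) ^ 2 = β := by rw [inv_pow, Real.sq_sqrt hβ0.le, one_div, inv_inv]
    have hf : (fun u : Matrix.specialUnitaryGroup (Fin N) ℂ => Real.exp (-(1 / ((Real.sqrt β)⁻¹) ^ 2) * (1 - GaugeGroup.reTr u))) =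
        plaqFactor (G := Matrix.specialUnitaryGroup (Fin N) ℂ) β := by
      funext u; rw [hα]; rfl
    unfold B16ZLower.zNorm linkMass
    rw [hf]
    exact setIntegral_le_integral (integrable_plaqFactor β) (Filter.Eventually.of_forall fun u => (plaqFactor_pos β u).le)
  have hzpos : 0 < B16ZLower.zNorm (Matrix.specialUnitaryGroup (Fin N) ℂ) ((Real.sqrt β)⁻¹ ^ 2) 1 := by
    have h := B16ZLower.zNorm_specialUnitaryGroup_ge (N := N) (α := (Real.sqrt β)⁻¹ ^ 2) (r := 1 / 2) (ε₀ := 1) (pow_pos hg 2) (by norm_num) (by norm_num)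
    exact lt_of_lt_of_le (by positivity) h
  have hlow := B16ZLower.log_zNorm_specialUnitaryGroup_ge (N := N) hg hg1 one_pos
  have hlogg : Real.log (Real.sqrt β)⁻¹ = -(1 / 2) * Real.log β := by rw [Real.log_inv, Real.log_sqrt hβ0.le]; ring
  rw [hlogg] at hlow
  have hmono := Real.log_le_log hzpos hz
  linarith

/-! ## §2. The Gaussian upper bound on `log Z` -/

/-- **★★★ THE GAUSSIAN UPPER BOUND ON BAŁABAN's FINE-LATTICE WILSON PARTITION FUNCTION, `G = SU(N)`.**  For every `Params` `P` and every `β ≥ 1`: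
`log Z_P(β) ≤ −((d−1)(N²−1)∕2)·(1−1∕n)·|T₁^{(0)}|·log β + (d−1)(1−1∕n)|T₁^{(0)}|·log(D_N T_N)`, `n = 2L^{m+K}` — the axial-tree comparison × the one-plaquette Laplace bound. [folklore] -/
theorem log_partitionFn_le_gaussian_specialUnitary (P : Params) {β : ℝ} (hβ : 1 ≤ β) :
    Real.log (partitionFn (G := Matrix.specialUnitaryGroup (Fin N) ℂ) P β) ≤
      ((P.d : ℝ) - 1) * (Fintype.card (Site P 0) : ℝ) * (1 - 1 / (P.sitesPerDir 0 : ℝ)) *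
        (-((((N * N : ℕ) : ℝ) - 1) / 2) * Real.log β +
          Real.log (max (Real.pi * (haarChartConst N : ℝ) * 5 ^ (N * N) * (volume (Metric.closedBall (0 : EuclideanSpace ℝ (Fin N × Fin N)) 1)).toReal) (10 ^ (N * N - 1))
            * (∑' k : ℕ, ((k : ℝ) + 1) ^ (N * N - 1) * Real.exp (-(1 / (2 * (N : ℝ)))) ^ k))) := by
  have hβ0 : 0 < β := lt_of_lt_of_le one_pos hβ
  have h1 := log_partitionFn_le_axialTree P (G := Matrix.specialUnitaryGroup (Fin N) ℂ) hβ0.le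
  have h2 := log_linkMass_SU_le N hβ0
  have hcoef : 0 ≤ ((P.d : ℝ) - 1) * (Fintype.card (Site P 0) : ℝ) * (1 - 1 / (P.sitesPerDir 0 : ℝ)) := by
    have hd : (1 : ℝ) ≤ (P.d : ℝ) := by exact_mod_cast P.hd
    have hn : (1 : ℝ) ≤ (P.sitesPerDir 0 : ℝ) := by exact_mod_cast Nat.pos_of_ne_zero (P.sitesPerDir_ne_zero 0)
    have : 0 ≤ 1 - 1 / (P.sitesPerDir 0 : ℝ) := by
      rw [sub_nonneg, div_le_one (lt_of_lt_of_le one_pos hn)]; exact hn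
    have : 0 ≤ (P.d : ℝ) - 1 := by linarith
    positivity
  exact h1.trans (mul_le_mul_of_nonneg_left h2 hcoef)

/-- **`d = 4`**: `log Z_P(β) ≤ 3(1−1∕n)|T₁^{(0)}|·(−((N²−1)∕2) log β + log(D_N T_N))` for `β ≥ 1`. [folklore] -/
theorem log_partitionFn_le_gaussian_specialUnitary_d4 (P : Params) (hd : P.d = 4) {β : ℝ} (hβ : 1 ≤ β) :
    Real.log (partitionFn (G := Matrix.specialUnitaryGroup (Fin N) ℂ) P β) ≤
      3 * (Fintype.card (Site P 0) : ℝ) * (1 - 1 / (P.sitesPerDir 0 : ℝ)) *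
        (-((((N * N : ℕ) : ℝ) - 1) / 2) * Real.log β +
          Real.log (max (Real.pi * (haarChartConst N : ℝ) * 5 ^ (N * N) * (volume (Metric.closedBall (0 : EuclideanSpace ℝ (Fin N × Fin N)) 1)).toReal) (10 ^ (N * N - 1))
            * (∑' k : ℕ, ((k : ℝ) + 1) ^ (N * N - 1) * Real.exp (-(1 / (2 * (N : ℝ)))) ^ k))) := by
  have h := log_partitionFn_le_gaussian_specialUnitary N P hβ
  have hd4 : (P.d : ℝ) - 1 = 3 := by rw [show (P.d : ℝ) = 4 by exact_mod_cast hd]; norm_num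
  rwa [hd4] at h

/-! ## §3. Two-sided: the transversal Gaussian count of the four-torus in the kernel -/

/-- **★★★ TWO-SIDED GAUSSIAN ASYMPTOTICS OF `log Z` (`d = 4`, `G = SU(N)`, `β ≥ 1`)**:
`−(3 + 1∕n)|T₁^{(0)}|·(((N²−1)∕2) log β + C_N) − 128|T₁^{(0)}| ≤ log Z_P(β) ≤ 3(1 − 1∕n)|T₁^{(0)}|·(−((N²−1)∕2) log β + log(D_N T_N))`
(`C_N = N² log(16π+1) + log((2N+1)∕(4π))`; lower = p639903's layered Faddeev–Popov bound, upper = §2): `log Z_P(β) = −(3∕2)(N²−1)|T₁^{(0)}|·log β·(1 + O(1∕n)) + O(|T₁^{(0)}|)`. [folklore] -/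
theorem log_partitionFn_twoSided_gaussian_d4 (P : Params) (hd : P.d = 4) {β : ℝ} (hβ : 1 ≤ β) :
    -((3 + (P.sitesPerDir 0 : ℝ)⁻¹) * (Fintype.card (Site P 0) : ℝ)) *
          ((((N * N : ℕ) : ℝ) - 1) / 2 * Real.log β + (((N * N : ℕ) : ℝ) * Real.log (16 * Real.pi + 1) + Real.log ((2 * N + 1) / (4 * Real.pi))))
        - 128 * (Fintype.card (Site P 0) : ℝ) ≤
        Real.log (partitionFn (G := Matrix.specialUnitaryGroup (Fin N) ℂ) P β) ∧
      Real.log (partitionFn (G := Matrix.specialUnitaryGroup (Fin N) ℂ) P β) ≤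
        3 * (Fintype.card (Site P 0) : ℝ) * (1 - 1 / (P.sitesPerDir 0 : ℝ)) *
          (-((((N * N : ℕ) : ℝ) - 1) / 2) * Real.log β +
            Real.log (max (Real.pi * (haarChartConst N : ℝ) * 5 ^ (N * N) * (volume (Metric.closedBall (0 : EuclideanSpace ℝ (Fin N × Fin N)) 1)).toReal) (10 ^ (N * N - 1))
              * (∑' k : ℕ, ((k : ℝ) + 1) ^ (N * N - 1) * Real.exp (-(1 / (2 * (N : ℝ)))) ^ k))) :=
  ⟨log_partitionFn_ge_axialLayers_specialUnitary_d4 N P hd hβ, log_partitionFn_le_gaussian_specialUnitary_d4 N P hd hβ⟩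

end Summit.QuantumFields.YangMills.BalabanUVNodes.N13WilsonPartitionFnGaussianUpperBoundSU

end
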